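import Literature.NumberTheory.QuadraticFields.KroneckerCharacterExists
import Literature.NumberTheory.QuadraticFields.HeegnerCondition
import Literature.NumberTheory.EllipticCurves.QuadraticTwistKroneckerEvenLFunctionProofs
import HarnessLib

/-!
# The Kronecker character of a quadratic field carries the Dirichlet coefficients of the twist
# `E^{(d_K)}` (cell `bsd-addord`, seat `bsd-addord-gz` gen 4; helper for the kernel form of `hFact`)

HONEST FRAMING (cell `bsd-addord`; PARTITION (D-0054): EXCLUDED-DOMAIN additive rows §E, B6 = O7-ord r1 —
types-the-object-of; booked 0). THEOREMS ONLY. For a quadratic field `K` (discriminant `d_K`) there is a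
Dirichlet character `κ` mod `|d_K|` with the Artin-fact values of lit's p408789
(`κ(ℓ) = (d_K/ℓ)` at odd primes, `κ(2) ∈ {1,−1,0}` by `d_K mod 8`) AND, for every elliptic `E/ℚ` with
good reduction at the primes of `d_K`, `a_n(E^{(d_K)}) = κ(n)·a_n(E)` for ALL `n`
(`exists_kroneckerChar_twistCoeff`). Assembled from the tree: the construction of
`exists_kroneckerChar` (Cox Lemma 1.14) and the closed forms `LFunction_quadraticTwist_apply_of_emod_four_eq_one`
/ `LFunction_quadraticTwist_apply_of_four_dvd_discr` (Silverman X.2 Prop. 2.4, Ex. 10.16).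

References: [Cox2013] §1.C Lemma 1.14; [SilvermanAEC2009] X.2 Prop. 2.4, Exercise 10.16.
-/

set_option autoImplicit false

noncomputable section

open scoped Classical NumberTheorySymbols NumberField

open WeierstrassCurve NumberField IsDedekindDomain Rat.HeightOneSpectrum
  Literature.NumberTheory.QuadraticFields Literature.NumberTheory.QuadraticFields.Quadratic

namespace Summit.BirchSwinnertonDyer.Rank1Residual.Additive

/-- **The Kronecker character of `K` carries the coefficients of the twist by `d_K`.** For a quadratic
field `K` there is a Dirichlet character `κ` mod `|d_K|` with `κ(ℓ) = (d_K/ℓ)` at odd primes `ℓ`,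
`κ(2) = 1, −1, 0` according as `d_K ≡ 1, 5 (mod 8)` or `d_K` even, and `a_n(E^{(d_K)}) = κ(n)·a_n(E)` for
every `n` and every elliptic `E/ℚ` with good reduction at the primes dividing `d_K`.
[cite: Cox2013, §1.C Lemma 1.14] [cite: SilvermanAEC2009, X.2 Prop. 2.4 and Exercise 10.16] -/
theorem exists_kroneckerChar_twistCoeff (K : Type) [Field K] [NumberField K]
    (h2 : Module.finrank ℚ K = 2) :
    ∃ κ : DirichletCharacter ℂ (NumberField.discr K).natAbs,
      (∀ p : ℕ, p.Prime → p ≠ 2 → κ p = (jacobiSym (NumberField.discr K) p : ℂ)) ∧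
      (κ 2 = if NumberField.discr K % 8 = 1 then 1
        else if NumberField.discr K % 8 = 5 then -1 else 0) ∧
      ∀ (V : WeierstrassCurve ℚ) [V.IsElliptic],
        (∀ v : HeightOneSpectrum (𝓞 ℚ), ((primesEquiv v : ℕ) : ℤ) ∣ NumberField.discr K →
          V.HasGoodReductionAt v) →
        ∀ n : ℕ, (((V.quadraticTwist (NumberField.discr K : ℚ)).LFunction n : ℤ) : ℂ) =
          κ n * ((V.LFunction n : ℤ) : ℂ) := by
  -- adapted from Literature/NumberTheory/QuadraticFields/KroneckerCharacterExists.lean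
  set D := NumberField.discr K with hDdef
  have hD0 : D ≠ 0 := NumberField.discr_ne_zero K
  haveI : NeZero D.natAbs := ⟨Int.natAbs_ne_zero.mpr hD0⟩
  rcases discr_emod_four h2 with h4 | h4
  · -- even discriminant `D = 4m`: the character mod `4|m|` with values `(m/n)` at odd `n`
    obtain ⟨m, hm⟩ : (4 : ℤ) ∣ D := Int.dvd_of_emod_eq_zero h4
    have hm0 : m ≠ 0 := by rintro rfl; exact hD0 (by rw [hm, mul_zero])
    have hd : D.natAbs = 4 * m.natAbs := by omega
    have hDm : D / 4 = m := by rw [hm, Int.mul_ediv_cancel_left _ four_ne_zero]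
    obtain ⟨κ, hκodd, hκeven⟩ : ∃ κ : DirichletCharacter ℂ D.natAbs,
        (∀ n : ℕ, Odd n → κ n = (J(m | n) : ℂ)) ∧ (∀ n : ℕ, Even n → κ n = 0) := by
      rw [hd]
      obtain ⟨χ, hχ⟩ := exists_dirichletCharacter_four_mul m hm0
      haveI : NeZero (4 * m.natAbs) := ⟨by omega⟩
      refine ⟨χ, hχ, fun n hn ↦ apply_eq_zero_of_even ?_⟩
      rw [ZMod.val_natCast]
      have h2q : Even (4 * m.natAbs * (n / (4 * m.natAbs))) :=
        (show Even (4 * m.natAbs) from ⟨2 * m.natAbs, by ring⟩).mul_right _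
      have h' : Even (n % (4 * m.natAbs) + 4 * m.natAbs * (n / (4 * m.natAbs))) := by
        rwa [Nat.mod_add_div]
      exact (Nat.even_add.mp h').mpr h2q
    refine ⟨κ, fun p hp hp2 ↦ ?_, ?_, fun V _ hgood n ↦ ?_⟩
    · have hpodd : Odd p := hp.odd_of_ne_two hp2
      have hgcd : (2 : ℤ).gcd p = 1 := by
        rw [show (2 : ℤ) = ((2 : ℕ) : ℤ) from rfl, Int.gcd_natCast_natCast]
        exact (Nat.coprime_primes Nat.prime_two hp).mpr (Ne.symm hp2)
      rw [hκodd p hpodd, hm, jacobiSym.mul_left, show (4 : ℤ) = 2 ^ 2 by norm_num,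
        jacobiSym.sq_one' hgcd, one_mul]
    · have h81 : D % 8 ≠ 1 := by omega
      have h85 : D % 8 ≠ 5 := by omega
      rw [← Nat.cast_ofNat, hκeven 2 even_two, if_neg h81, if_neg h85]
    · rw [V.LFunction_quadraticTwist_apply_of_four_dvd_discr K h2 ⟨m, hm⟩ hgood n]
      rcases Nat.even_or_odd n with hn | hn
      · rw [if_pos hn, hκeven n hn]
        push_cast
        ring
      · rw [if_neg (Nat.not_even_iff_odd.mpr hn), hκodd n hn, ← hDdef, hDm]
        push_cast
        ring
  · -- odd discriminant `D ≡ 1 (mod 4)`: the Jacobi character `(·/|D|)`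
    have hsq : Squarefree D := by
      rcases isFundamentalDiscriminant_discr (K := K) h2 with ⟨-, hsq, -⟩ | ⟨h4', -, -⟩
      · exact hsq
      · exfalso
        obtain ⟨k, hk⟩ := h4'
        omega
    refine ⟨jacobiChar D.natAbs, fun p hp hp2 ↦ ?_, ?_, fun V _ hgood n ↦ ?_⟩
    · rw [jacobiChar_natCast, jacobiSym_natAbs_eq_of_emod_four_eq_one h4 (hp.odd_of_ne_two hp2)]
    · rw [← Nat.cast_ofNat, jacobiChar_natCast, Nat.cast_ofNat]
      by_cases h81 : D % 8 = 1
      · rw [if_pos h81, (jacobiSym_two_natAbs_eq_one_iff h4).mpr h81, Int.cast_one]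
      · have h85 : D % 8 = 5 := by omega
        rw [if_neg h81, if_pos h85, (jacobiSym_two_natAbs_eq_neg_one_iff h4).mpr h85]
        push_cast
        ring
    · rw [V.LFunction_quadraticTwist_apply_of_emod_four_eq_one h4 hsq hgood n, jacobiChar_natCast]
      push_cast
      ring

end Summit.BirchSwinnertonDyer.Rank1Residual.Additive

end
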